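import Summits.ValiantsHypothesis.ValiantsHypothesis.Theorems.GrenetZeonTwoDimCoefficientsUnitReducedTop
import Summits.ValiantsHypothesis.ValiantsHypothesis.Theorems.GrenetZeonTwoDimCoefficientsStubUnitDichotomy
import HarnessLib

/-!
# Crux `GrenetZeon.TwoDimCoefficients` (stmt-ValiantsHypothesis-8062), line `dim2_cases`:
# calibration of the registered stub `stub_unitDichotomy`

Two kernel-checked facts behind the seat's census of `stub_unitDichotomy` (`UnitDichotomy`: an affine
`m × m` determinant with no zero on `Z(per_n)`, `n ≥ 3`, is constant or `n² ≤ 2m + 2`):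

* `unit_dichotomy_up_to_powerful_top` — WHAT IS PROVED.  Combining `unit_trichotomy`
  (`…UnitCase`) with the reduced case (`…UnitReducedTop`): the dichotomy holds except possibly when
  `det A = c + per_n · q` with `q ≠ 0` and `per_n ∣ top(q)` (the top homogeneous component of `q`);
  in particular it holds whenever `deg(det A) < 2n`.
* `sq_bound_of_unitDichotomy` — WHAT THE STUB SILENTLY CONTAINS.  `UnitDichotomy` implies, for every
  `a, b ≠ 0` and every affine `m × m` matrix `A` with `det A = (a + b·per_n)²`, the bound
  `n² ≤ 2m + 2` — a determinantal-complexity lower bound for a SQUARE, `dc((a + b per_n)²) ≥ (n²-2)/2`,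
  out of reach of the Hessian method (every zero of a square is a double zero) and not in print.
* `splitRepr_of_det_eq_sq` — and such squares DO occur in the crux: `per_n = u² - w²` with
  `u = (per_n + 1)/2`, `w = (per_n - 1)/2` is a SPLIT representation (`SplitRepr n m`) as soon as
  `u²` and `w²` are affine `m × m` determinants.

HONEST FRAMING: bookkeeping for an ASIDE item; nothing here bears on `VP ≠ VNP`.
-/

set_option linter.dupNamespace false

noncomputable section

namespace Summit.ValiantsHypothesis.ValiantsHypothesis.Cruxes.TwoDimCoefficients.DimTwoCases

open MvPolynomial Matrix
open Literature.Computability.AlgebraicComplexity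

/-- **The unit dichotomy up to the powerful-top residue.**  For `n ≥ 3` and an affine `m × m` matrix
`A` whose determinant has no zero on `Z(per_n)`: `det A` is constant, or `n² ≤ 2m + 2`, or
`det A = c + per_n · q` with `q ≠ 0` and `per_n ∣ top(q)`. -/
theorem unit_dichotomy_up_to_powerful_top {n : ℕ} (hn : 3 ≤ n) (m : ℕ) (A : AffMat n m)
    (hA : IsAffine A)
    (hZ : ∀ p : Fin n × Fin n → ℂ, eval p (perPoly (Fin n) ℂ) = 0 → eval p A.det ≠ 0) :
    (∃ c : ℂ, A.det = C c) ∨ n ^ 2 ≤ 2 * m + 2 ∨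
      ∃ (c : ℂ) (q : MvPolynomial (Fin n × Fin n) ℂ), q ≠ 0 ∧
        A.det = C c + perPoly (Fin n) ℂ * q ∧
        perPoly (Fin n) ℂ ∣ homogeneousComponent q.totalDegree q := by
  rcases unit_trichotomy hn m A hA hZ with h | h | ⟨c, q, -, hq, hdet⟩
  · exact Or.inl h
  · exact Or.inr (Or.inl (by omega))
  · have hq0 : q ≠ 0 := by rintro rfl; simp at hq
    by_cases hdvd : perPoly (Fin n) ℂ ∣ homogeneousComponent q.totalDegree q
    · exact Or.inr (Or.inr ⟨c, q, hq0, hdet, hdvd⟩)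
    · exact Or.inr (Or.inl (sq_le_two_mul_add_two_of_det_eq_of_not_dvd hn A hA hq0 hdet hdvd))

/-- The unit dichotomy holds whenever `deg (det A) < 2n` (then `deg q < n`, so `per_n ∤ top(q)`). -/
theorem unit_dichotomy_of_totalDegree_lt {n : ℕ} (hn : 3 ≤ n) (m : ℕ) (A : AffMat n m)
    (hA : IsAffine A)
    (hZ : ∀ p : Fin n × Fin n → ℂ, eval p (perPoly (Fin n) ℂ) = 0 → eval p A.det ≠ 0)
    (hdeg : A.det.totalDegree < 2 * n) :
    (∃ c : ℂ, A.det = C c) ∨ n ^ 2 ≤ 2 * m + 2 := by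
  haveI : Nonempty (Fin n) := ⟨⟨0, by omega⟩⟩
  rcases unit_trichotomy hn m A hA hZ with h | h | ⟨c, q, -, hq, hdet⟩
  · exact Or.inl h
  · exact Or.inr (by omega)
  · have hq0 : q ≠ 0 := by rintro rfl; simp at hq
    refine Or.inr (sq_le_two_mul_add_two_of_det_eq_of_totalDegree_lt hn A hA hq0 hdet ?_)
    -- `deg (c + per q) = n + deg q < 2n`
    have hper : (perPoly (Fin n) ℂ).totalDegree = n := by
      rw [(totalDegree_perPoly_holds (n := Fin n) (k := ℂ) : (perPoly (Fin n) ℂ).totalDegree = _),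
        Fintype.card_fin]
    have hprod : (perPoly (Fin n) ℂ * q).totalDegree = n + q.totalDegree := by
      rw [totalDegree_mul_of_isDomain (perPoly_irreducible (n := Fin n) (R := ℂ)).ne_zero hq0, hper]
    have hsum : (C c + perPoly (Fin n) ℂ * q).totalDegree = n + q.totalDegree := by
      rw [totalDegree_add_eq_right_of_totalDegree_lt, hprod]
      rw [hprod, totalDegree_C]
      omega
    rw [hdet, hsum] at hdeg
    omega

/-- **What `UnitDichotomy` silently asserts.**  The registered stub implies the lower bound
`n² ≤ 2m + 2` for every affine `m × m` representation of the SQUARE `(a + b·per_n)²`, `a b ≠ 0`. -/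
theorem sq_bound_of_unitDichotomy (h : UnitDichotomy) {n : ℕ} (hn : 3 ≤ n) {m : ℕ}
    (A : AffMat n m) (hA : IsAffine A) {a b : ℂ} (ha : a ≠ 0) (hb : b ≠ 0)
    (hdet : A.det = (C a + C b * perPoly (Fin n) ℂ) ^ 2) : n ^ 2 ≤ 2 * m + 2 := by
  haveI : Nonempty (Fin n) := ⟨⟨0, by omega⟩⟩
  have hZ : ∀ p : Fin n × Fin n → ℂ, eval p (perPoly (Fin n) ℂ) = 0 → eval p A.det ≠ 0 := by
    intro p hp
    rw [hdet, map_pow, map_add, eval_C, map_mul, eval_C, hp, mul_zero, add_zero]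
    exact pow_ne_zero _ ha
  rcases h n hn m A hA hZ with ⟨c, hc⟩ | hle
  · exfalso
    -- `(a + b per)²` has degree `2n ≠ 0`
    have hlin : (C a + C b * perPoly (Fin n) ℂ).totalDegree = n := by
      have hper : (perPoly (Fin n) ℂ).totalDegree = n := by
        rw [(totalDegree_perPoly_holds (n := Fin n) (k := ℂ) : (perPoly (Fin n) ℂ).totalDegree = _),
          Fintype.card_fin]
      have hmul : (C b * perPoly (Fin n) ℂ).totalDegree = n := by
        rw [totalDegree_mul_of_isDomain (by rwa [Ne, C_eq_zero])
          (perPoly_irreducible (n := Fin n) (R := ℂ)).ne_zero, totalDegree_C, zero_add, hper]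
      rw [totalDegree_add_eq_right_of_totalDegree_lt] <;> rw [hmul]
      rw [totalDegree_C]; omega
    have hne : C a + C b * perPoly (Fin n) ℂ ≠ 0 := by
      intro h0; rw [h0, totalDegree_zero] at hlin; omega
    have hsq : ((C a + C b * perPoly (Fin n) ℂ) ^ 2).totalDegree = 2 * n := by
      rw [sq, totalDegree_mul_of_isDomain hne hne, hlin]; ring
    rw [← hdet, hc, totalDegree_C] at hsq
    omega
  · exact hle

/-- **Squares occur in the split shape.**  `per_n = u² - w²` with `u = (per_n + 1)/2`,
`w = (per_n - 1)/2`: affine `m × m` representations of the two squares give a SPLIT representation of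
`per_n` of size `m`. -/
theorem splitRepr_of_det_eq_sq {n m : ℕ} (A B : AffMat n m) (hA : IsAffine A) (hB : IsAffine B)
    (hdA : A.det = (C 2⁻¹ + C 2⁻¹ * perPoly (Fin n) ℂ) ^ 2)
    (hdB : B.det = (C (-2⁻¹) + C 2⁻¹ * perPoly (Fin n) ℂ) ^ 2) : SplitRepr n m := by
  refine ⟨1, -1, A, B, hA, hB, ?_⟩
  have hneg : (C (-2⁻¹ : ℂ) : MvPolynomial (Fin n × Fin n) ℂ) = -C 2⁻¹ := map_neg C _
  rw [hdA, hdB, hneg, map_one, map_neg, map_one]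
  have h4 : (C (2⁻¹ : ℂ) : MvPolynomial (Fin n × Fin n) ℂ) * C 2⁻¹ * 4 = 1 := by
    rw [← C_mul, show (4 : MvPolynomial (Fin n × Fin n) ℂ) = C 4 from (map_ofNat C 4).symm,
      ← C_mul, show ((2 : ℂ)⁻¹ * 2⁻¹ * 4 : ℂ) = 1 by norm_num, C_1]
  linear_combination (-(perPoly (Fin n) ℂ)) * h4

/-! ### Addendum (after p580672): the bound is unconditional

`stub_unitDichotomy : UnitDichotomy` was LANDED by seat val-width-8062-p3
(`…GrenetZeonTwoDimCoefficientsStubUnitDichotomy`, the isotropy / kernel-plane form of Mignon–Ressayre,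
which uses only the zero SET of `det A` and is therefore blind to powers).  So the bound that
`sq_bound_of_unitDichotomy` extracts from the stub is simply TRUE, and the phrase "out of reach of the
Hessian method … not in print" in this file's header describes the Hessian-of-`det A` ROUTE only, not
the statement; the "powerful residue" of `unit_dichotomy_up_to_powerful_top` is closed by p3's theorem.
The seat's earlier `stub-misstated` census note on the item is retracted (evidence
`retraction-unitDichotomy.md`). -/

/-- **Unconditional square bound.** Every affine `m × m` matrix whose determinant is
`(a + b·per_n)²` (`a, b ≠ 0`, `n ≥ 3`) has `n² ≤ 2m + 2`; p3's
`sq_le_two_mul_of_det_eq_C_add_perPoly_mul` even gives `n² ≤ 2m`. -/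
theorem sq_bound_of_det_eq_sq {n : ℕ} (hn : 3 ≤ n) {m : ℕ} (A : AffMat n m) (hA : IsAffine A)
    {a b : ℂ} (ha : a ≠ 0) (hb : b ≠ 0) (hdet : A.det = (C a + C b * perPoly (Fin n) ℂ) ^ 2) :
    n ^ 2 ≤ 2 * m + 2 :=
  sq_bound_of_unitDichotomy stub_unitDichotomy hn A hA ha hb hdet

/-- **The unit dichotomy, unconditionally** (restated from p3's `stub_unitDichotomy` in the
trichotomy vocabulary of `…UnitCase`): constant, or `n² ≤ 2m + 2` — no residue. -/
theorem unit_dichotomy {n : ℕ} (hn : 3 ≤ n) (m : ℕ) (A : AffMat n m) (hA : IsAffine A)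
    (hZ : ∀ p : Fin n × Fin n → ℂ, eval p (perPoly (Fin n) ℂ) = 0 → eval p A.det ≠ 0) :
    (∃ c : ℂ, A.det = C c) ∨ n ^ 2 ≤ 2 * m + 2 :=
  stub_unitDichotomy n hn m A hA hZ

end Summit.ValiantsHypothesis.ValiantsHypothesis.Cruxes.TwoDimCoefficients.DimTwoCases
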